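import Summits.NavierStokesRegularity.NavierStokesRegularity.Theorems.CorkscrewDynamoCorkscrewProfileOfRssProfileExists
import Summits.NavierStokesRegularity.NavierStokesRegularity.Theorems.CorkscrewDynamoCorkscrewProfileOfQuarterTurnProfileExists
import Literature.Analysis.FluidPDE.TypeIAncientMild
import HarnessLib

/-!
# Route CorkscrewDynamo · crux `CorkscrewProfile` (stmt-NavierStokesRegularity-11282) — angle tools (lead c3, line `registered`)

Rotation bookkeeping for the normal form / irrational-angle bridge of the crux (`CorkscrewDynamoCorkscrewProfileNormalForm`):
coordinate pinning `R = rotZ θ`, `2π`-periodicity and angle-continuity of `rotZ`, DENSITY of `ℤθ + 2πℤ` for `θ/2π`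
irrational, hence **equivariance of a continuous field under one irrational rotation is axisymmetry**
(`isAxisymmetric_of_equivariant_irrational`); **KNSS 2009 Thm 5.3 in the Oseen gauge** — a Type-I ancient mild field
`IsTypeIAncientMild C V` with `HasTypeIDecay C₀ V` and axisymmetric slices vanishes (`typeIAncientMild_eq_zero_of_isAxisymmetric`,
through `knss_bound_C_over_r_holds` on a time shift); and the reading of plain `c`-DSS of a rotated-DSS slice as
`R_θ`-equivariance (`nsRescale_eq_rotZ_conj`). Registered tools stub: `stub_corkscrewAngleTools`.
-/

noncomputable section

open Set Function MeasureTheory Filter Topology Literature.Analysis.FluidPDE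

namespace Summit.NavierStokesRegularity.NavierStokesRegularity.Theorems.CorkscrewProfile.Birth

set_option linter.dupNamespace false

/-! ### Rotations about `e₃`: pinning, periodicity, continuity in the angle, dense angle groups -/

/-- A linear isometry pinned BY COORDINATES to the rotation by `θ` about `e₃` is `rotZ θ`. -/
theorem eq_rotZ_of_pinned {R : EuclideanSpace ℝ (Fin 3) ≃ₗᵢ[ℝ] EuclideanSpace ℝ (Fin 3)} {θ : ℝ}
    (hR : ∀ x : EuclideanSpace ℝ (Fin 3), R x 0 = Real.cos θ * x 0 - Real.sin θ * x 1 ∧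
      R x 1 = Real.sin θ * x 0 + Real.cos θ * x 1 ∧ R x 2 = x 2)
    (x : EuclideanSpace ℝ (Fin 3)) : R x = rotZ θ x := by
  obtain ⟨h0, h1, h2⟩ := hR x
  ext i
  fin_cases i
  · simpa using h0
  · simpa using h1
  · simpa using h2

/-- The inverse of a coordinate-pinned rotation is `rotZ (−θ)`. -/
theorem symm_eq_rotZ_neg_of_pinned {R : EuclideanSpace ℝ (Fin 3) ≃ₗᵢ[ℝ] EuclideanSpace ℝ (Fin 3)} {θ : ℝ}
    (hR : ∀ x : EuclideanSpace ℝ (Fin 3), R x 0 = Real.cos θ * x 0 - Real.sin θ * x 1 ∧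
      R x 1 = Real.sin θ * x 0 + Real.cos θ * x 1 ∧ R x 2 = x 2)
    (x : EuclideanSpace ℝ (Fin 3)) : R.symm x = rotZ (-θ) x := by
  apply R.injective
  rw [LinearIsometryEquiv.apply_symm_apply, eq_rotZ_of_pinned hR, ← rotZ_add, add_neg_cancel, rotZ_zero]

/-- `rotZLIE θ` is pinned by coordinates to the rotation by `θ` about `e₃`. -/
theorem rotZLIE_pinned_coord (θ : ℝ) (x : EuclideanSpace ℝ (Fin 3)) :
    rotZLIE θ x 0 = Real.cos θ * x 0 - Real.sin θ * x 1 ∧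
      rotZLIE θ x 1 = Real.sin θ * x 0 + Real.cos θ * x 1 ∧ rotZLIE θ x 2 = x 2 := by
  simp

/-- `2π`-periodicity of the rotations about `e₃`: `R_{φ + 2πn} = R_φ`. -/
theorem rotZ_add_int_mul_two_pi (φ : ℝ) (n : ℤ) (x : EuclideanSpace ℝ (Fin 3)) :
    rotZ (φ + n * (2 * Real.pi)) x = rotZ φ x := by
  ext i
  fin_cases i <;> simp [Real.cos_add_int_mul_two_pi, Real.sin_add_int_mul_two_pi]

/-- The orbit map `s ↦ R_s x` is continuous. -/
theorem continuous_rotZ_angle' (x : EuclideanSpace ℝ (Fin 3)) : Continuous fun s : ℝ => rotZ s x := by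
  unfold rotZ
  refine (PiLp.continuous_toLp 2 _).comp ?_
  refine continuous_pi fun i => ?_
  have hc : Continuous fun θ : ℝ => Real.cos θ := Real.continuous_cos
  have hs : Continuous fun θ : ℝ => Real.sin θ := Real.continuous_sin
  fin_cases i
  · exact ((hc.mul (continuous_const (y := x 0))).sub
      (hs.mul (continuous_const (y := x 1)))).congr fun θ => by simp
  · exact ((hs.mul (continuous_const (y := x 0))).add
      (hc.mul (continuous_const (y := x 1)))).congr fun θ => by simp
  · exact (continuous_const (y := x 2)).congr fun θ => by simp

/-- **Irrational angles generate a dense group**: if `θ/2π` is irrational, the subgroup `ℤθ + 2πℤ` of `ℝ`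
is dense (an additive subgroup of `ℝ` is dense or cyclic; a cyclic one containing `θ` and `2π` makes `θ/2π`
rational). -/
theorem dense_zmultiples_add_of_irrational {θ : ℝ} (hθ : Irrational (θ / (2 * Real.pi))) :
    Dense (AddSubgroup.closure ({θ, 2 * Real.pi} : Set ℝ) : Set ℝ) := by
  rcases AddSubgroup.dense_or_cyclic (AddSubgroup.closure ({θ, 2 * Real.pi} : Set ℝ)) with hd | ⟨a, ha⟩
  · exact hd
  · exfalso
    have hθmem : θ ∈ AddSubgroup.closure ({a} : Set ℝ) := by
      rw [← ha]; exact AddSubgroup.subset_closure (by simp)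
    have hπmem : 2 * Real.pi ∈ AddSubgroup.closure ({a} : Set ℝ) := by
      rw [← ha]; exact AddSubgroup.subset_closure (by simp)
    obtain ⟨k, hk⟩ := AddSubgroup.mem_closure_singleton.1 hθmem
    obtain ⟨l, hl⟩ := AddSubgroup.mem_closure_singleton.1 hπmem
    have hπ0 : (2 * Real.pi) ≠ 0 := by positivity
    have hl0 : (l : ℝ) ≠ 0 := by
      rintro hl0'
      apply hπ0
      rw [← hl, zsmul_eq_mul, hl0', zero_mul]
    have ha0 : a ≠ 0 := by
      rintro rfl
      apply hπ0
      rw [← hl, smul_zero]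
    apply hθ
    refine ⟨(k : ℚ) / l, ?_⟩
    rw [Rat.cast_div, Rat.cast_intCast, Rat.cast_intCast, ← hk, ← hl, zsmul_eq_mul, zsmul_eq_mul]
    field_simp

/-- **Equivariance under one irrational rotation is axisymmetry** (continuous fields): if `V` is continuous and
`V (R_θ y) = R_θ (V y)` for all `y` with `θ/2π` irrational, then `V` is axisymmetric. The set of angles of
equivariance is a closed subgroup containing `θ` and `2π`, hence everything. -/
theorem isAxisymmetric_of_equivariant_irrational {V : EuclideanSpace ℝ (Fin 3) → EuclideanSpace ℝ (Fin 3)}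
    (hV : Continuous V) {θ : ℝ} (hθ : Irrational (θ / (2 * Real.pi)))
    (h : ∀ y, V (rotZ θ y) = rotZ θ (V y)) : IsAxisymmetric V := by
  -- the set of angles of equivariance
  set T : Set ℝ := {s | ∀ y, V (rotZ s y) = rotZ s (V y)} with hT
  have hTclosed : IsClosed T := by
    have e : T = ⋂ y, {s | V (rotZ s y) = rotZ s (V y)} := by
      ext s
      simp only [hT, mem_setOf_eq, mem_iInter]
    rw [e]
    exact isClosed_iInter fun y =>
      isClosed_eq (hV.comp (continuous_rotZ_angle' y)) (continuous_rotZ_angle' (V y))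
  -- it is an additive subgroup
  have hT0 : (0 : ℝ) ∈ T := fun y => by simp [rotZ_zero]
  have hTadd : ∀ s ∈ T, ∀ s' ∈ T, s + s' ∈ T := fun s hs s' hs' y => by
    show V (rotZ (s + s') y) = rotZ (s + s') (V y)
    rw [rotZ_add, hs, hs', ← rotZ_add]
  have hTneg : ∀ s ∈ T, -s ∈ T := fun s hs y => by
    show V (rotZ (-s) y) = rotZ (-s) (V y)
    have h1 := hs (rotZ (-s) y)
    rw [← rotZ_add, add_neg_cancel, rotZ_zero] at h1
    rw [h1, ← rotZ_add, neg_add_cancel, rotZ_zero]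
  set S : AddSubgroup ℝ :=
    { carrier := T
      add_mem' := fun {s s'} hs hs' => hTadd s hs s' hs'
      zero_mem' := hT0
      neg_mem' := fun {s} hs => hTneg s hs } with hS
  have hθT : θ ∈ T := h
  have hπT : 2 * Real.pi ∈ T := fun y => by
    show V (rotZ (2 * Real.pi) y) = rotZ (2 * Real.pi) (V y)
    have e : ∀ z : EuclideanSpace ℝ (Fin 3), rotZ (2 * Real.pi) z = z := fun z => by
      have h1 := rotZ_add_int_mul_two_pi 0 1 z
      rw [zero_add, Int.cast_one, one_mul, rotZ_zero] at h1
      exact h1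
    rw [e, e]
  have hsub : (AddSubgroup.closure ({θ, 2 * Real.pi} : Set ℝ) : Set ℝ) ⊆ T := by
    have hle : AddSubgroup.closure ({θ, 2 * Real.pi} : Set ℝ) ≤ S :=
      (AddSubgroup.closure_le S).2 (by
        rintro s (rfl | rfl)
        · exact hθT
        · exact hπT)
    intro s hs
    exact hle hs
  have hTuniv : T = univ := by
    have hd : Dense T := (dense_zmultiples_add_of_irrational hθ).mono hsub
    rw [← hTclosed.closure_eq, hd.closure_eq]
  intro φ y
  have hφ : φ ∈ T := by rw [hTuniv]; exact mem_univ _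
  exact hφ y

/-! ### A Type-I ancient mild field in the Oseen gauge with axisymmetric slices vanishes (KNSS Thm 5.3) -/

/-- **KNSS for the Oseen gauge class.** A field `V` with `IsTypeIAncientMild C V`, `HasTypeIDecay C₀ V` and
axisymmetric slices vanishes identically on `t < 0`: for `t₀ < 0` the translate `V(· + t₀/2)` is a bounded
axisymmetric ancient mild solution with `r‖V‖ ≤ C₀`, so its slices vanish a.e. (`knss_bound_C_over_r_holds`), in
particular `V t₀` does; being continuous it vanishes everywhere. -/
theorem typeIAncientMild_eq_zero_of_isAxisymmetric {C C₀ : ℝ}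
    {V : ℝ → EuclideanSpace ℝ (Fin 3) → EuclideanSpace ℝ (Fin 3)} (hV : IsTypeIAncientMild C V)
    (hdec : HasTypeIDecay C₀ V) (hax : ∀ t < 0, IsAxisymmetric (V t)) {t₀ : ℝ} (ht₀ : t₀ < 0)
    (x : EuclideanSpace ℝ (Fin 3)) : V t₀ x = 0 := by
  have hC₀ : 0 ≤ C₀ := by
    have h := hdec (-1) (by norm_num) 0
    rw [norm_zero, zero_add, neg_neg, Real.sqrt_one, div_one] at h
    exact (norm_nonneg _).trans h
  set b : ℝ := t₀ / 2 with hb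
  have hb0 : b < 0 := by rw [hb]; linarith
  set v : ℝ → EuclideanSpace ℝ (Fin 3) → EuclideanSpace ℝ (Fin 3) := fun t => V (t + b) with hv
  have hvmild : IsAncientMildSolution 1 v := hV.isAncientMildSolution.time_translate hb0.le
  have hvbdd : IsBoundedOn (Iio 0) v := by
    refine ⟨C₀ / Real.sqrt (-b), fun t ht x => ?_⟩
    have ht' : t + b < 0 := by have : t < 0 := ht; linarith
    have hs : Real.sqrt (-b) ≤ Real.sqrt (-(t + b)) := Real.sqrt_le_sqrt (by have : t < 0 := ht; linarith)
    have hs0 : 0 < Real.sqrt (-b) := Real.sqrt_pos.2 (by linarith)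
    calc ‖v t x‖ = ‖V (t + b) x‖ := rfl
      _ ≤ C₀ / (‖x‖ + Real.sqrt (-(t + b))) := hdec _ ht' x
      _ ≤ C₀ / Real.sqrt (-b) := by
          apply div_le_div_of_nonneg_left hC₀ hs0
          linarith [norm_nonneg x]
  have hvmeas : ∀ t < 0, AEStronglyMeasurable (v t) volume := fun t ht =>
    hV.aestronglyMeasurable_slice (by linarith)
  have hvax : ∀ t < 0, IsAxisymmetric (v t) := fun t ht => hax (t + b) (by linarith)
  have hvC : ∃ C' : ℝ, ∀ t < 0, ∀ x, cylRadius x * ‖v t x‖ ≤ C' := by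
    refine ⟨C₀, fun t ht x => ?_⟩
    have ht' : t + b < 0 := by linarith
    have hs : 0 < Real.sqrt (-(t + b)) := Real.sqrt_pos.2 (by linarith)
    have hden : 0 < ‖x‖ + Real.sqrt (-(t + b)) := by positivity
    have hcyl : cylRadius x ≤ ‖x‖ := by
      rw [cylRadius, EuclideanSpace.norm_eq]
      apply Real.sqrt_le_sqrt
      simp only [Fin.sum_univ_three, Real.norm_eq_abs, sq_abs]
      nlinarith [sq_nonneg (x 2)]
    calc cylRadius x * ‖v t x‖ ≤ ‖x‖ * (C₀ / (‖x‖ + Real.sqrt (-(t + b)))) :=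
          mul_le_mul hcyl (hdec _ ht' x) (norm_nonneg _) (norm_nonneg _)
      _ = C₀ * (‖x‖ / (‖x‖ + Real.sqrt (-(t + b)))) := by ring
      _ ≤ C₀ * 1 := by
          apply mul_le_mul_of_nonneg_left _ hC₀
          rw [div_le_one hden]
          linarith [hs.le]
      _ = C₀ := mul_one _
  have hzero := knss_bound_C_over_r_holds ⟨hvmild, hvbdd⟩ hvmeas hvax hvC b hb0
  have e : v b = V t₀ := by
    show V (b + b) = V t₀
    congr 1
    rw [hb]; ring
  rw [e] at hzero
  have hVt : V t₀ = 0 :=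
    (Continuous.ae_eq_iff_eq volume (hV.continuous_slice ht₀) continuous_const).1 hzero
  rw [hVt]
  rfl

/-! ### Rescaling a smooth rotated-DSS field: plain DSS a.e. is plain DSS, and plain DSS is slice equivariance -/

/-- Transport of a slice-wise a.e. equality through the parabolic rescaling `x ↦ c x` at time `c²t`. -/
theorem nsRescale_ae_congr {c : ℝ} (hc : 0 < c)
    {u V : ℝ → EuclideanSpace ℝ (Fin 3) → EuclideanSpace ℝ (Fin 3)} {t : ℝ}
    (h : V (c ^ 2 * t) =ᵐ[volume] u (c ^ 2 * t)) : nsRescale c V t =ᵐ[volume] nsRescale c u t := by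
  have hq : Measure.QuasiMeasurePreserving (fun x : EuclideanSpace ℝ (Fin 3) => c • x) volume volume :=
    Measure.quasiMeasurePreserving_smul volume hc.ne'
  filter_upwards [hq.ae h] with x hx
  rw [nsRescale_apply, nsRescale_apply]
  exact congrArg (c • ·) hx

/-- For a rotated-DSS field with pinned rotation, plain `c`-DSS of the slice `t` IS `R_θ`-equivariance of the slice:
`nsRescale c V t x = R_θ (V t (R_{−θ} x))`. -/
theorem nsRescale_eq_rotZ_conj {c θ : ℝ} {R : EuclideanSpace ℝ (Fin 3) ≃ₗᵢ[ℝ] EuclideanSpace ℝ (Fin 3)}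
    (hR : ∀ x : EuclideanSpace ℝ (Fin 3), R x 0 = Real.cos θ * x 0 - Real.sin θ * x 1 ∧
      R x 1 = Real.sin θ * x 0 + Real.cos θ * x 1 ∧ R x 2 = x 2)
    {V : ℝ → EuclideanSpace ℝ (Fin 3) → EuclideanSpace ℝ (Fin 3)} (hV : IsRotatedDSS c R V) (t : ℝ)
    (x : EuclideanSpace ℝ (Fin 3)) : nsRescale c V t x = rotZ θ (V t (rotZ (-θ) x)) := by
  rw [nsRescale_eq_conj_of_isRotatedDSS hV t]
  show R (V t (R.symm x)) = _
  rw [eq_rotZ_of_pinned hR, symm_eq_rotZ_neg_of_pinned hR]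


/-! ### Registered tools stub -/

/-- **Registered tools stub `stub_corkscrewAngleTools`** (crux stmt-NavierStokesRegularity-11282, lead c3): one irrational
rotation of equivariance makes a continuous field axisymmetric; an Oseen-gauge Type-I ancient mild field with axisymmetric
slices vanishes (KNSS 2009 Thm 5.3). -/
theorem stub_corkscrewAngleTools :
    (∀ (V : EuclideanSpace ℝ (Fin 3) → EuclideanSpace ℝ (Fin 3)) (θ : ℝ), Continuous V →
      Irrational (θ / (2 * Real.pi)) →
      (∀ y, V (Literature.Analysis.FluidPDE.rotZ θ y) = Literature.Analysis.FluidPDE.rotZ θ (V y)) →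
      Literature.Analysis.FluidPDE.IsAxisymmetric V) ∧
    (∀ (C C₀ : ℝ) (V : ℝ → EuclideanSpace ℝ (Fin 3) → EuclideanSpace ℝ (Fin 3)),
      Literature.Analysis.FluidPDE.IsTypeIAncientMild C V → Literature.Analysis.FluidPDE.HasTypeIDecay C₀ V →
      (∀ t < 0, Literature.Analysis.FluidPDE.IsAxisymmetric (V t)) → ∀ t₀ < 0, ∀ x, V t₀ x = 0) :=
  ⟨fun _ _ hV hθ h => isAxisymmetric_of_equivariant_irrational hV hθ h,
    fun _ _ _ hV hdec hax _ ht₀ x => typeIAncientMild_eq_zero_of_isAxisymmetric hV hdec hax ht₀ x⟩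

end Summit.NavierStokesRegularity.NavierStokesRegularity.Theorems.CorkscrewProfile.Birth

end
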